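import Summits.AnomalousDissipation.AnomalousDissipation.Theses.PumpedMirror
import Summits.AnomalousDissipation.AnomalousDissipation.Theorems.PumpedMirrorMirrorBoundedFromRestTGStubMirrorSchemeFromRest
import Summits.AnomalousDissipation.AnomalousDissipation.Theorems.PumpedMirrorMirrorBoundedFromRestTGStubLimitInheritsMirrorBound
import Summits.AnomalousDissipation.AnomalousDissipation.Theorems.PumpedMirrorMirrorBoundedFromRestTGTransient
import Literature.Analysis.FluidPDE.NSHopfLimit
import Literature.Analysis.FluidPDE.NSGalerkinTrajectory

/-!
# Birth skeleton for crux `PumpedMirror.MirrorBoundedFromRestTG` (stmt-AnomalousDissipation-15373, rank 3)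

Skeleton registrar `planner-skel-stmt-AnomalousDissipation-15373-0`, 2026-08-17 (route re-audit bin REPAIRABLE;
published as `Cruxes/MirrorBoundedFromRestTG/Lines/birth.lean`).

## The crux (read back from the route file, rev 2)

`MirrorBoundedFromRestTG` (B of the thesis `X = A ∧ B`): for the pinned Taylor–Green force `f_TG` there are
`E, ν₁ > 0` such that for every `ν ∈ (0, ν₁)` SOME global Leray–Hopf solution of `NS_ν(f_TG)` from rest, with an
`H`-lift `U` (`U t = u t` a.e., `t ≥ 0`) whose slices are `K`-symmetric a.e. (`K` = the three coordinate
mirrors `x_i ↦ -x_i`, `u_j ↦ (−1)^{δ_ij} u_j`), satisfies `‖U t‖² ≤ E` for all `t ≥ 0` — a PATHWISE,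
ν-UNIFORM energy bound for the Taylor–Green flow from rest inside its symmetry class.

## The cut (route header, TWO-LAYER PLAN: `MirrorLhFromRest → MirrorTransientCeiling → B`, k = 2, made typable)

"The sup-energy of THAT construction" needs the construction to be a first-class object. It is one already:
the tree's Hopf–Galerkin scheme predicate `Literature.Analysis.FluidPDE.IsHopfGalerkinScheme` (NSHopfGalerkin.lean;
both halves of Hopf's theorem DISCHARGED: `hopf_galerkin_scheme_exists_holds`, `hopf_galerkin_limit_holds`, and the
`x₃`-translation-invariant twin `NSHopfInvariant.exists_isHopfGalerkinScheme_invariant` /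
`IsHopfGalerkinScheme.exists_invariant_limitField`, which are the templates for stubs A and C below). With the force
PINNED EXACTLY at every order (`F n t = f_TG`: `f_TG` is its own Galerkin truncation for `N² ≥ 3`) and the zero
datum, a scheme `(N, U)` is, order by order, THE unique solution of the Galerkin ODE (tested equations against a
basis of `P_N H` + continuity + local Lipschitz uniqueness), i.e. exactly the object a symmetric TG DNS computes.

* `stub_mirrorSchemeFromRest` (A; provable now, M): for every `ν > 0` an exact-force Hopf–Galerkin scheme for
  `(ν, f_TG, 0)` whose slices `U n t`, `t ≥ 0`, are POINTWISE `K`-symmetric. Proof route: the `K`-fixed coefficient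
  subspace `{c : c(R_i k) = R_i c(k)}` of `galerkinSubspace S` is invariant under `galerkinRHS` for forces in
  `Fix K` (twin of `galerkinRHS_mem_axisCoeffSubspace`), so `NSHopfInvariant.exists_galerkin_solution_of_invariant`
  runs the Galerkin ODE inside it from `c₀ = 0`; clauses of the scheme as in `exists_isHopfGalerkinScheme` with
  `F n = f_TG` (smooth steady real trigonometric polynomial: `contDiff_stLift_realTrigPoly`).
* `stub_galerkinCeilingFromRest` (B′; THE HEART, open): `∃ E ν₁ > 0 ∀ ν ∈ (0,ν₁) ∃ N₀ :` every exact-force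
  `K`-symmetric scheme from rest obeys `∫ |U n t|² ≤ E` for all `t ≥ 0` at every order `N n ≥ N₀` — the
  ν-UNIFORM, RESOLUTION-UNIFORM pathwise energy bound for the `K`-symmetric Taylor–Green GALERKIN flow from rest.
  The threshold `N₀ = N₀(ν)` is necessary, not cosmetic: at order `N = 2` the truncation `P₂[(u·∇)u]` of the TG
  mode is a pure pressure gradient, the Galerkin flow from rest is the laminar ray `a(t) f_TG`,
  `a' = 1 − 12π²ν a`, and its energy saturates at `‖f_TG‖²/(144π⁴ν²) → ∞`; more generally an under-resolved
  truncation thermalises and absorbs the input only at energy `≳ 1/(ν N²)`. So B′ is a statement about RESOLVED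
  Galerkin systems (`N ≳ ν^{-3/4}` expected), killable by the route's cheapest falsifier (iii) (symmetric TG DNS
  from rest at three viscosities, recording `sup_t ∫|u|²`).
* `stub_limitInheritsMirrorBound` (C; provable now, M/L): an exact-force scheme for `(ν, f_TG, 0)`, `ν > 0`, with
  `K`-symmetric slices and `∫ |U n t|² ≤ E` (`n ∈ ℕ`, `t ≥ 0`) has a global Leray–Hopf limit from rest with an
  `H`-lift that is `K`-symmetric a.e. and obeys `‖U t‖² ≤ E` for all `t ≥ 0`. Proof route:
  `IsHopfGalerkinScheme.exists_limitField` (coefficientwise convergence of EVERY slice `t ≥ 0` along a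
  subsequence) + `isLerayHopfOn_limit`; the bound passes by Parseval–Fatou (`integral_norm_sq_limit_le` pattern);
  `K`-symmetry is the closed linear coefficient relation `û(R_i k) = R_i û(k)`, preserved under pointwise limits
  of coefficients, giving a.e. symmetry of the slice (`Torus.ae_eq_of_mFourierCoeff_complexify_eq` pattern); the
  lift as in `Theorems/TaylorCertificatesZeroDatumLerayHopf.exists_energySpace_lift_of_isGlobalLerayHopf_zero`
  (`f_TG` smooth with zero mean: `TaylorGreenForceRegularTG`, proved inline in `PumpedMirror.closes`).

Assembly (kernel-checked below): `stubComposition : StubComposition` (= A → B′ → C → crux, the pure composition,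
axioms propext/Classical.choice/Quot.sound) and the REGISTERED hypothesis-free skeleton theorem
`MirrorBoundedFromRestTG_of : MirrorBoundedFromRestTG := stubComposition stub_A stub_B′ stub_C` (by-name audit shape:
`sorry` only inside the three declared stubs). Content: take
`E, ν₁` from B′; for `ν < ν₁` take `N₀`, a scheme from A, pass to its TAIL `n ↦ n + n₀` with `N (n + n₀) ≥ N₀`
(`tendsto_order`; a tail of a scheme is a scheme, `IsHopfGalerkinScheme.comp_strictMono`), apply B′ along the
tail and hand the bounded symmetric tail to C.

Costume / shredding self-check: no stub mentions a Leray–Hopf solution AND a ν-uniform bound together (A: no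
bound; B′: Galerkin ODE solutions only, no Leray–Hopf object; C: one fixed `ν`, conditional); B′ is neither the
crux (different objects, plus the resolution threshold) nor implied by it (Galerkin-vs-Leray–Hopf closeness for
all time would need 3-D regularity); three stubs, none bookkeeping. Disproof.lean: none exists for this crux yet
(`ledger crux ls`: no workfiles); negatives index: the refuted universal ceilings (2979/2984/2859) are Galilean
drift / free-datum statements — here datum `0`, force pinned, class `Fix K` (zero momentum), so none instantiates.
-/

namespace Summit.AnomalousDissipation.AnomalousDissipation.Cruxes.MirrorBoundedFromRestTG.Birth

-- the mandated namespace repeats `AnomalousDissipation` (single-conjunct summit)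
set_option linter.dupNamespace false

open MeasureTheory Filter Set Function
open Summit.AnomalousDissipation.AnomalousDissipation.Theses.PumpedMirror

/-- **Stub A — `K`-symmetric exact-force Hopf–Galerkin scheme from rest for `f_TG`** (provable now, M; the
`Fix K` twin of `Literature.Analysis.FluidPDE.exists_isHopfGalerkinScheme_invariant`): for every `ν > 0` there is
a Hopf–Galerkin scheme `(N, U)` for `(ν, f_TG, 0)` driven at every order by the exact force `f_TG`, all of whose
slices `U n t`, `t ≥ 0`, are pointwise `K`-symmetric:
`U n t (R_i x) j = (−1)^{δ_ij} U n t x j`, `R_i x = update x i (−x i)`. -/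
theorem stub_mirrorSchemeFromRest :
    ∀ f : UnitAddTorus (Fin 3) → EuclideanSpace ℝ (Fin 3), f = (fun x => !₂[(fourier 1 (x 0) : ℂ).im * (fourier 1 (x 1) : ℂ).re * (fourier 1 (x 2) : ℂ).re, -((fourier 1 (x 0) : ℂ).re * (fourier 1 (x 1) : ℂ).im * (fourier 1 (x 2) : ℂ).re), (0 : ℝ)]) →
      ∀ ν : ℝ, 0 < ν →
        ∃ (N : ℕ → ℕ) (U : ℕ → ℝ → UnitAddTorus (Fin 3) → EuclideanSpace ℝ (Fin 3)),
          Literature.Analysis.FluidPDE.IsHopfGalerkinScheme ν (fun _ => f) 0 N (fun _ _ => f) U ∧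
          ∀ (n : ℕ) (t : ℝ), 0 ≤ t → ∀ (i j : Fin 3) (x : UnitAddTorus (Fin 3)),
            U n t (Function.update x i (-x i)) j = if j = i then -(U n t x j) else U n t x j :=
  -- LANDED (wave 1, p144899): Theorems/PumpedMirrorMirrorBoundedFromRestTGStubMirrorSchemeFromRest.lean
  Summit.AnomalousDissipation.AnomalousDissipation.Theorems.PumpedMirror.MirrorBoundedFromRestTG.SchemeFromRest.stub_mirrorSchemeFromRest

/-- **Stub B′₁ — the ν-uniform, order-uniform TRANSIENT from rest** (PROVED, p148833, in
`Theorems/PumpedMirrorMirrorBoundedFromRestTGTransient.lean` from the tree's uniform `L²` bound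
`IsHopfGalerkinScheme.integral_norm_sq_le`, RRS 2016 (4.8), with datum `0` and the exact steady force): for
EVERY `ν ≥ 0`, every exact-force Hopf–Galerkin scheme for `(ν, f_TG, 0)`, every order `n` and every `t ≥ 0`,
`∫ |U n t|² ≤ t²` (`∫ |f_TG|² = 1/4`; energy identity + Young). No symmetry and no resolution threshold are
needed: energy methods DO control the initial window uniformly. -/
theorem stub_galerkinTransientFromRest :
    ∀ f : UnitAddTorus (Fin 3) → EuclideanSpace ℝ (Fin 3), f = (fun x => !₂[(fourier 1 (x 0) : ℂ).im * (fourier 1 (x 1) : ℂ).re * (fourier 1 (x 2) : ℂ).re, -((fourier 1 (x 0) : ℂ).re * (fourier 1 (x 1) : ℂ).im * (fourier 1 (x 2) : ℂ).re), (0 : ℝ)]) →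
      ∀ ν : ℝ, 0 ≤ ν →
        ∀ (N : ℕ → ℕ) (U : ℕ → ℝ → UnitAddTorus (Fin 3) → EuclideanSpace ℝ (Fin 3)),
          Literature.Analysis.FluidPDE.IsHopfGalerkinScheme ν (fun _ => f) 0 N (fun _ _ => f) U →
          ∀ (n : ℕ) (t : ℝ), 0 ≤ t → ∫ x, ‖U n t x‖ ^ 2 ≤ t ^ 2 :=
  -- LANDED (lead, p148833): Theorems/PumpedMirrorMirrorBoundedFromRestTGTransient.lean
  Summit.AnomalousDissipation.AnomalousDissipation.Theorems.PumpedMirror.MirrorBoundedFromRestTG.Transient.stub_galerkinTransientFromRest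

/-- **Stub B′₂ — the ν-uniform, resolution-uniform LATE ceiling of the Taylor–Green Galerkin flow
from rest** (THE HEART of the crux, open; trajectory form, reshaped 2026-08-17 by the lead): there are
`E > 0`, `T₀ ≥ 0`, `ν₁ > 0` such that for every `ν ∈ (0, ν₁)` some resolution threshold `N₀` makes every
GALERKIN TRAJECTORY of order `m ≥ N₀` of `NS_ν(f_TG)` FROM REST (`Torus.IsGalerkinTrajectory ν f_TG m U`,
`U 0 = 0`: at each `(ν, m)` this is ONE object, the order-`m` Galerkin solution from the zero datum —
`FromRest.galerkinTrajectoryFromRest_unique`; it is automatically `K`-symmetric, the hypothesis is kept for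
convenience) satisfy `∫ |U t|² ≤ E` for all LATE times `t ≥ T₀` — the statistically-steady energy level
of the resolved symmetric Taylor–Green Galerkin flow from rest is `O(1)` AND is reached within a
ν-independent time (what a symmetric TG DNS measures; falsifier (iii): jobs j023063–67). Given the
transient B′₁ this is EQUIVALENT to the former stub B′ (`lateCeiling_of_traj`,
`galerkinCeiling_of_transient_of_late`; conversely B′ ⇒ B′₂ with `T₀ := 0` by splicing the trajectory
into a scheme). `N₀(ν)` is necessary: at order 2 the flow from rest is the laminar ray `a(t) f_TG`,
`a' = 1 − 12π²ν a`, with late energy `‖f_TG‖²/(144π⁴ν²)`. -/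
theorem stub_galerkinLateCeilingTrajFromRest :
    ∀ f : UnitAddTorus (Fin 3) → EuclideanSpace ℝ (Fin 3), f = (fun x => !₂[(fourier 1 (x 0) : ℂ).im * (fourier 1 (x 1) : ℂ).re * (fourier 1 (x 2) : ℂ).re, -((fourier 1 (x 0) : ℂ).re * (fourier 1 (x 1) : ℂ).im * (fourier 1 (x 2) : ℂ).re), (0 : ℝ)]) →
      ∃ (E T₀ ν₁ : ℝ), 0 < E ∧ 0 ≤ T₀ ∧ 0 < ν₁ ∧ ∀ ν : ℝ, 0 < ν → ν < ν₁ → ∃ N₀ : ℕ,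
        ∀ (m : ℕ) (U : ℝ → UnitAddTorus (Fin 3) → EuclideanSpace ℝ (Fin 3)), N₀ ≤ m →
          Literature.Analysis.FluidPDE.Torus.IsGalerkinTrajectory ν f m U → U 0 = 0 →
          (∀ t : ℝ, 0 ≤ t → ∀ (i j : Fin 3) (x : UnitAddTorus (Fin 3)),
            U t (Function.update x i (-x i)) j = if j = i then -(U t x j) else U t x j) →
          ∀ t : ℝ, T₀ ≤ t → ∫ x, ‖U t x‖ ^ 2 ≤ E := by
  sorry

/-- From rest every member of a Hopf–Galerkin scheme starts at the zero field (`∫ ‖U n 0‖² ≤ ∫ ‖0‖² = 0`,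
`IsHopfGalerkinScheme.integral_norm_sq_zero_le`, and continuity of the slice). Copy of
`FromRest.slice_zero_eq_zero` (support file `…FromRestUnique.lean`, landing) kept here so that the
workfile elaborates on its own. [folklore] -/
theorem slice_zero_eq_zero' {ν : ℝ} {g : ℝ → UnitAddTorus (Fin 3) → EuclideanSpace ℝ (Fin 3)} {N : ℕ → ℕ}
    {F U : ℕ → ℝ → UnitAddTorus (Fin 3) → EuclideanSpace ℝ (Fin 3)}
    (hS : Literature.Analysis.FluidPDE.IsHopfGalerkinScheme ν g 0 N F U) (n : ℕ) : U n 0 = 0 := by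
  have hle : ∫ x, ‖U n 0 x‖ ^ 2 ≤ 0 := by
    have h := hS.integral_norm_sq_zero_le (MemLp.zero' (ε := EuclideanSpace ℝ (Fin 3))) n
    simpa using h
  have hc : Continuous (U n 0) := hS.continuous_slice n le_rfl
  have hint : Integrable (fun x => ‖U n 0 x‖ ^ 2) volume := (hc.norm.pow 2).integrable_unitAddTorus
  have h0 : ∫ x, ‖U n 0 x‖ ^ 2 = 0 := le_antisymm hle (integral_nonneg fun x => sq_nonneg _)
  have hae : (fun x => ‖U n 0 x‖ ^ 2) =ᵐ[volume] 0 :=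
    (integral_eq_zero_iff_of_nonneg (fun x => sq_nonneg _) hint).1 h0
  have heq : (fun x => ‖U n 0 x‖ ^ 2) = 0 := (hc.norm.pow 2).ae_eq_iff_eq volume continuous_const |>.1 hae
  funext x
  have hx := congrFun heq x
  simp only [Pi.zero_apply, ne_eq, OfNat.ofNat_ne_zero, not_false_eq_true, pow_eq_zero_iff, norm_eq_zero] at hx
  rw [hx, Pi.zero_apply]

/-- **Glue B′₂(trajectory form) → B′₂(scheme form)** (kernel-checked, sorry-free): every member `U n` of an
exact-force Hopf–Galerkin scheme from rest is a Galerkin trajectory of order `N n`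
(`IsHopfGalerkinScheme.isGalerkinTrajectory`) starting at `0` (`slice_zero_eq_zero'`), so the late ceiling
for trajectories from rest gives the late ceiling for schemes (same `E, T₀, ν₁, N₀`). The conclusion is
VERBATIM the former registered stub `stub_galerkinLateCeilingFromRest` (scheme form). -/
theorem lateCeiling_of_traj
    (hL : ∀ f : UnitAddTorus (Fin 3) → EuclideanSpace ℝ (Fin 3), f = (fun x => !₂[(fourier 1 (x 0) : ℂ).im * (fourier 1 (x 1) : ℂ).re * (fourier 1 (x 2) : ℂ).re, -((fourier 1 (x 0) : ℂ).re * (fourier 1 (x 1) : ℂ).im * (fourier 1 (x 2) : ℂ).re), (0 : ℝ)]) →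
      ∃ (E T₀ ν₁ : ℝ), 0 < E ∧ 0 ≤ T₀ ∧ 0 < ν₁ ∧ ∀ ν : ℝ, 0 < ν → ν < ν₁ → ∃ N₀ : ℕ,
        ∀ (m : ℕ) (U : ℝ → UnitAddTorus (Fin 3) → EuclideanSpace ℝ (Fin 3)), N₀ ≤ m →
          Literature.Analysis.FluidPDE.Torus.IsGalerkinTrajectory ν f m U → U 0 = 0 →
          (∀ t : ℝ, 0 ≤ t → ∀ (i j : Fin 3) (x : UnitAddTorus (Fin 3)),
            U t (Function.update x i (-x i)) j = if j = i then -(U t x j) else U t x j) →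
          ∀ t : ℝ, T₀ ≤ t → ∫ x, ‖U t x‖ ^ 2 ≤ E) :
    ∀ f : UnitAddTorus (Fin 3) → EuclideanSpace ℝ (Fin 3), f = (fun x => !₂[(fourier 1 (x 0) : ℂ).im * (fourier 1 (x 1) : ℂ).re * (fourier 1 (x 2) : ℂ).re, -((fourier 1 (x 0) : ℂ).re * (fourier 1 (x 1) : ℂ).im * (fourier 1 (x 2) : ℂ).re), (0 : ℝ)]) →
      ∃ (E T₀ ν₁ : ℝ), 0 < E ∧ 0 ≤ T₀ ∧ 0 < ν₁ ∧ ∀ ν : ℝ, 0 < ν → ν < ν₁ → ∃ N₀ : ℕ,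
        ∀ (N : ℕ → ℕ) (U : ℕ → ℝ → UnitAddTorus (Fin 3) → EuclideanSpace ℝ (Fin 3)),
          Literature.Analysis.FluidPDE.IsHopfGalerkinScheme ν (fun _ => f) 0 N (fun _ _ => f) U →
          (∀ (n : ℕ) (t : ℝ), 0 ≤ t → ∀ (i j : Fin 3) (x : UnitAddTorus (Fin 3)),
            U n t (Function.update x i (-x i)) j = if j = i then -(U n t x j) else U n t x j) →
          ∀ n : ℕ, N₀ ≤ N n → ∀ t : ℝ, T₀ ≤ t → ∫ x, ‖U n t x‖ ^ 2 ≤ E := by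
  intro f hf
  obtain ⟨E, T₀, ν₁, hE, hT₀, hν₁, hlate⟩ := hL f hf
  refine ⟨E, T₀, ν₁, hE, hT₀, hν₁, fun ν hν hνlt => ?_⟩
  obtain ⟨N₀, hN₀⟩ := hlate ν hν hνlt
  refine ⟨N₀, fun N U hS hsym n hn t ht => ?_⟩
  exact hN₀ (N n) (U n) hn (hS.isGalerkinTrajectory n) (slice_zero_eq_zero' hS n)
    (fun τ hτ i j x => hsym n τ hτ i j x) t ht

/-- **Glue B′₁ → B′₂ → B′** (kernel-checked, sorry-free): the ν-uniform transient `∫ |U n t|² ≤ t²` on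
`[0, T₀]` and the ν-uniform late ceiling `E` on `[T₀, ∞)` give the ν-uniform pathwise ceiling
`max E T₀²` for all `t ≥ 0` (same `ν₁`, same thresholds `N₀`). The conclusion is VERBATIM the former stub B′
`stub_galerkinCeilingFromRest` of the birth skeleton (= the middle hypothesis of `StubComposition`), RESHAPED
2026-08-17 by the lead into the two registered stubs `stub_galerkinTransientFromRest` (PROVED) and
`stub_galerkinLateCeilingFromRest` (open); conversely B′ gives B′₂ with `T₀ := 0`, so nothing is lost. -/
theorem galerkinCeiling_of_transient_of_late
    (hT : ∀ f : UnitAddTorus (Fin 3) → EuclideanSpace ℝ (Fin 3), f = (fun x => !₂[(fourier 1 (x 0) : ℂ).im * (fourier 1 (x 1) : ℂ).re * (fourier 1 (x 2) : ℂ).re, -((fourier 1 (x 0) : ℂ).re * (fourier 1 (x 1) : ℂ).im * (fourier 1 (x 2) : ℂ).re), (0 : ℝ)]) →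
      ∀ ν : ℝ, 0 ≤ ν →
        ∀ (N : ℕ → ℕ) (U : ℕ → ℝ → UnitAddTorus (Fin 3) → EuclideanSpace ℝ (Fin 3)),
          Literature.Analysis.FluidPDE.IsHopfGalerkinScheme ν (fun _ => f) 0 N (fun _ _ => f) U →
          ∀ (n : ℕ) (t : ℝ), 0 ≤ t → ∫ x, ‖U n t x‖ ^ 2 ≤ t ^ 2)
    (hL : ∀ f : UnitAddTorus (Fin 3) → EuclideanSpace ℝ (Fin 3), f = (fun x => !₂[(fourier 1 (x 0) : ℂ).im * (fourier 1 (x 1) : ℂ).re * (fourier 1 (x 2) : ℂ).re, -((fourier 1 (x 0) : ℂ).re * (fourier 1 (x 1) : ℂ).im * (fourier 1 (x 2) : ℂ).re), (0 : ℝ)]) →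
      ∃ (E T₀ ν₁ : ℝ), 0 < E ∧ 0 ≤ T₀ ∧ 0 < ν₁ ∧ ∀ ν : ℝ, 0 < ν → ν < ν₁ → ∃ N₀ : ℕ,
        ∀ (N : ℕ → ℕ) (U : ℕ → ℝ → UnitAddTorus (Fin 3) → EuclideanSpace ℝ (Fin 3)),
          Literature.Analysis.FluidPDE.IsHopfGalerkinScheme ν (fun _ => f) 0 N (fun _ _ => f) U →
          (∀ (n : ℕ) (t : ℝ), 0 ≤ t → ∀ (i j : Fin 3) (x : UnitAddTorus (Fin 3)),
            U n t (Function.update x i (-x i)) j = if j = i then -(U n t x j) else U n t x j) →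
          ∀ n : ℕ, N₀ ≤ N n → ∀ t : ℝ, T₀ ≤ t → ∫ x, ‖U n t x‖ ^ 2 ≤ E) :
    ∀ f : UnitAddTorus (Fin 3) → EuclideanSpace ℝ (Fin 3), f = (fun x => !₂[(fourier 1 (x 0) : ℂ).im * (fourier 1 (x 1) : ℂ).re * (fourier 1 (x 2) : ℂ).re, -((fourier 1 (x 0) : ℂ).re * (fourier 1 (x 1) : ℂ).im * (fourier 1 (x 2) : ℂ).re), (0 : ℝ)]) →
      ∃ (E ν₁ : ℝ), 0 < E ∧ 0 < ν₁ ∧ ∀ ν : ℝ, 0 < ν → ν < ν₁ → ∃ N₀ : ℕ,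
        ∀ (N : ℕ → ℕ) (U : ℕ → ℝ → UnitAddTorus (Fin 3) → EuclideanSpace ℝ (Fin 3)),
          Literature.Analysis.FluidPDE.IsHopfGalerkinScheme ν (fun _ => f) 0 N (fun _ _ => f) U →
          (∀ (n : ℕ) (t : ℝ), 0 ≤ t → ∀ (i j : Fin 3) (x : UnitAddTorus (Fin 3)),
            U n t (Function.update x i (-x i)) j = if j = i then -(U n t x j) else U n t x j) →
          ∀ n : ℕ, N₀ ≤ N n → ∀ t : ℝ, 0 ≤ t → ∫ x, ‖U n t x‖ ^ 2 ≤ E := by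
  intro f hf
  obtain ⟨E, T₀, ν₁, hE, hT₀, hν₁, hlate⟩ := hL f hf
  refine ⟨max E (T₀ ^ 2), ν₁, lt_max_of_lt_left hE, hν₁, fun ν hν hνlt => ?_⟩
  obtain ⟨N₀, hN₀⟩ := hlate ν hν hνlt
  refine ⟨N₀, fun N U hS hsym n hn t ht => ?_⟩
  rcases le_or_gt T₀ t with hle | hlt
  · exact (hN₀ N U hS hsym n hn t hle).trans (le_max_left _ _)
  · calc ∫ x, ‖U n t x‖ ^ 2 ≤ t ^ 2 := hT f hf ν hν.le N U hS n t ht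
      _ ≤ T₀ ^ 2 := by gcongr
      _ ≤ max E (T₀ ^ 2) := le_max_right _ _

/-- **Stub C — a bounded `K`-symmetric scheme has a bounded `K`-symmetric Leray–Hopf limit** (provable now,
M/L; the `Fix K` twin of `IsHopfGalerkinScheme.exists_invariant_limitField` + `isLerayHopfOn_limit` + the
`H`-lift of `exists_energySpace_lift_of_isGlobalLerayHopf_zero`, with the Parseval–Fatou passage of the pathwise
bound): for `ν > 0` and an exact-force Hopf–Galerkin scheme for `(ν, f_TG, 0)` with pointwise `K`-symmetric
slices and `∫ |U n t|² ≤ E` for all `n` and `t ≥ 0`, there is a global Leray–Hopf solution from rest with an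
`H`-lift, `K`-symmetric a.e., with `‖U t‖² ≤ E` for all `t ≥ 0`. -/
theorem stub_limitInheritsMirrorBound :
    ∀ f : UnitAddTorus (Fin 3) → EuclideanSpace ℝ (Fin 3), f = (fun x => !₂[(fourier 1 (x 0) : ℂ).im * (fourier 1 (x 1) : ℂ).re * (fourier 1 (x 2) : ℂ).re, -((fourier 1 (x 0) : ℂ).re * (fourier 1 (x 1) : ℂ).im * (fourier 1 (x 2) : ℂ).re), (0 : ℝ)]) →
      ∀ (ν E : ℝ), 0 < ν →
        ∀ (N : ℕ → ℕ) (U : ℕ → ℝ → UnitAddTorus (Fin 3) → EuclideanSpace ℝ (Fin 3)),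
          Literature.Analysis.FluidPDE.IsHopfGalerkinScheme ν (fun _ => f) 0 N (fun _ _ => f) U →
          (∀ (n : ℕ) (t : ℝ), 0 ≤ t → ∀ (i j : Fin 3) (x : UnitAddTorus (Fin 3)),
            U n t (Function.update x i (-x i)) j = if j = i then -(U n t x j) else U n t x j) →
          (∀ (n : ℕ) (t : ℝ), 0 ≤ t → ∫ x, ‖U n t x‖ ^ 2 ≤ E) →
          ∃ (u : ℝ → UnitAddTorus (Fin 3) → EuclideanSpace ℝ (Fin 3)) (V : ℝ → Literature.Analysis.FunctionSpaces.Torus.energySpace (Fin 3)),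
            Literature.Analysis.FluidPDE.Torus.IsGlobalLerayHopf ν (fun _ => f) 0 u ∧
            (∀ t, 0 ≤ t → ((V t : MeasureTheory.Lp (EuclideanSpace ℝ (Fin 3)) 2 (MeasureTheory.volume : MeasureTheory.Measure (UnitAddTorus (Fin 3)))) : UnitAddTorus (Fin 3) → EuclideanSpace ℝ (Fin 3)) =ᵐ[MeasureTheory.volume] u t) ∧
            (∀ t, 0 ≤ t → ∀ i j : Fin 3, (fun x => ((V t : MeasureTheory.Lp (EuclideanSpace ℝ (Fin 3)) 2 (MeasureTheory.volume : MeasureTheory.Measure (UnitAddTorus (Fin 3)))) : UnitAddTorus (Fin 3) → EuclideanSpace ℝ (Fin 3)) (Function.update x i (-x i)) j) =ᵐ[MeasureTheory.volume] (fun x => if j = i then -(((V t : MeasureTheory.Lp (EuclideanSpace ℝ (Fin 3)) 2 (MeasureTheory.volume : MeasureTheory.Measure (UnitAddTorus (Fin 3)))) : UnitAddTorus (Fin 3) → EuclideanSpace ℝ (Fin 3)) x j) else ((V t : MeasureTheory.Lp (EuclideanSpace ℝ (Fin 3)) 2 (MeasureTheory.volume : MeasureTheory.Measure (UnitAddTorus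 (Fin 3)))) : UnitAddTorus (Fin 3) → EuclideanSpace ℝ (Fin 3)) x j)) ∧
            (∀ t, 0 ≤ t → ‖V t‖ ^ 2 ≤ E) :=
  -- LANDED (wave 1, p145930): Theorems/PumpedMirrorMirrorBoundedFromRestTGStubLimitInheritsMirrorBound.lean
  Summit.AnomalousDissipation.AnomalousDissipation.Theorems.PumpedMirror.MirrorBoundedFromRestTG.LimitInherits.stub_limitInheritsMirrorBound

/-- **The composition statement**: the three stub statements (verbatim) imply the crux. Spelled as a named
proposition so that the by-name skeleton audit (`#h21_check_skeleton`) sees exactly ONE theorem concluding the crux,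
the registered hypothesis-free `MirrorBoundedFromRestTG_of` below; `stubComposition` is its sorry-free content
(axioms `propext`, `Classical.choice`, `Quot.sound` only). -/
abbrev StubComposition : Prop :=
    (∀ f : UnitAddTorus (Fin 3) → EuclideanSpace ℝ (Fin 3), f = (fun x => !₂[(fourier 1 (x 0) : ℂ).im * (fourier 1 (x 1) : ℂ).re * (fourier 1 (x 2) : ℂ).re, -((fourier 1 (x 0) : ℂ).re * (fourier 1 (x 1) : ℂ).im * (fourier 1 (x 2) : ℂ).re), (0 : ℝ)]) →
      ∀ ν : ℝ, 0 < ν →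
        ∃ (N : ℕ → ℕ) (U : ℕ → ℝ → UnitAddTorus (Fin 3) → EuclideanSpace ℝ (Fin 3)),
          Literature.Analysis.FluidPDE.IsHopfGalerkinScheme ν (fun _ => f) 0 N (fun _ _ => f) U ∧
          ∀ (n : ℕ) (t : ℝ), 0 ≤ t → ∀ (i j : Fin 3) (x : UnitAddTorus (Fin 3)),
            U n t (Function.update x i (-x i)) j = if j = i then -(U n t x j) else U n t x j) →
    (∀ f : UnitAddTorus (Fin 3) → EuclideanSpace ℝ (Fin 3), f = (fun x => !₂[(fourier 1 (x 0) : ℂ).im * (fourier 1 (x 1) : ℂ).re * (fourier 1 (x 2) : ℂ).re, -((fourier 1 (x 0) : ℂ).re * (fourier 1 (x 1) : ℂ).im * (fourier 1 (x 2) : ℂ).re), (0 : ℝ)]) →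
      ∃ (E ν₁ : ℝ), 0 < E ∧ 0 < ν₁ ∧ ∀ ν : ℝ, 0 < ν → ν < ν₁ → ∃ N₀ : ℕ,
        ∀ (N : ℕ → ℕ) (U : ℕ → ℝ → UnitAddTorus (Fin 3) → EuclideanSpace ℝ (Fin 3)),
          Literature.Analysis.FluidPDE.IsHopfGalerkinScheme ν (fun _ => f) 0 N (fun _ _ => f) U →
          (∀ (n : ℕ) (t : ℝ), 0 ≤ t → ∀ (i j : Fin 3) (x : UnitAddTorus (Fin 3)),
            U n t (Function.update x i (-x i)) j = if j = i then -(U n t x j) else U n t x j) →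
          ∀ n : ℕ, N₀ ≤ N n → ∀ t : ℝ, 0 ≤ t → ∫ x, ‖U n t x‖ ^ 2 ≤ E) →
    (∀ f : UnitAddTorus (Fin 3) → EuclideanSpace ℝ (Fin 3), f = (fun x => !₂[(fourier 1 (x 0) : ℂ).im * (fourier 1 (x 1) : ℂ).re * (fourier 1 (x 2) : ℂ).re, -((fourier 1 (x 0) : ℂ).re * (fourier 1 (x 1) : ℂ).im * (fourier 1 (x 2) : ℂ).re), (0 : ℝ)]) →
      ∀ (ν E : ℝ), 0 < ν →
        ∀ (N : ℕ → ℕ) (U : ℕ → ℝ → UnitAddTorus (Fin 3) → EuclideanSpace ℝ (Fin 3)),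
          Literature.Analysis.FluidPDE.IsHopfGalerkinScheme ν (fun _ => f) 0 N (fun _ _ => f) U →
          (∀ (n : ℕ) (t : ℝ), 0 ≤ t → ∀ (i j : Fin 3) (x : UnitAddTorus (Fin 3)),
            U n t (Function.update x i (-x i)) j = if j = i then -(U n t x j) else U n t x j) →
          (∀ (n : ℕ) (t : ℝ), 0 ≤ t → ∫ x, ‖U n t x‖ ^ 2 ≤ E) →
          ∃ (u : ℝ → UnitAddTorus (Fin 3) → EuclideanSpace ℝ (Fin 3)) (V : ℝ → Literature.Analysis.FunctionSpaces.Torus.energySpace (Fin 3)),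
            Literature.Analysis.FluidPDE.Torus.IsGlobalLerayHopf ν (fun _ => f) 0 u ∧
            (∀ t, 0 ≤ t → ((V t : MeasureTheory.Lp (EuclideanSpace ℝ (Fin 3)) 2 (MeasureTheory.volume : MeasureTheory.Measure (UnitAddTorus (Fin 3)))) : UnitAddTorus (Fin 3) → EuclideanSpace ℝ (Fin 3)) =ᵐ[MeasureTheory.volume] u t) ∧
            (∀ t, 0 ≤ t → ∀ i j : Fin 3, (fun x => ((V t : MeasureTheory.Lp (EuclideanSpace ℝ (Fin 3)) 2 (MeasureTheory.volume : MeasureTheory.Measure (UnitAddTorus (Fin 3)))) : UnitAddTorus (Fin 3) → EuclideanSpace ℝ (Fin 3)) (Function.update x i (-x i)) j) =ᵐ[MeasureTheory.volume] (fun x => if j = i then -(((V t : MeasureTheory.Lp (EuclideanSpace ℝ (Fin 3)) 2 (MeasureTheory.volume : MeasureTheory.Measure (UnitAddTorus (Fin 3)))) : UnitAddTorus (Fin 3) → EuclideanSpace ℝ (Fin 3)) x j) else ((V t : MeasureTheory.Lp (EuclideanSpace ℝ (Fin 3)) 2 (MeasureTheory.volume : MeasureTheory.Measure (UnitAddTorus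 (Fin 3)))) : UnitAddTorus (Fin 3) → EuclideanSpace ℝ (Fin 3)) x j)) ∧
            (∀ t, 0 ≤ t → ‖V t‖ ^ 2 ≤ E)) →
    Summit.AnomalousDissipation.AnomalousDissipation.Theses.PumpedMirror.MirrorBoundedFromRestTG

/-- **Assembly, pure form (kernel-checked, sorry-free closure): A → B′ → C → `MirrorBoundedFromRestTG`.** Take
`E, ν₁` from the Galerkin ceiling B′; for `ν ∈ (0, ν₁)` take its threshold `N₀` and a `K`-symmetric exact-force
scheme from A; a TAIL `n ↦ n + n₀` of the scheme is again a scheme (`IsHopfGalerkinScheme.comp_strictMono`) all of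
whose orders are `≥ N₀` (`tendsto_order`), so B′ bounds it pathwise by `E`; C turns the bounded symmetric tail into
the bounded symmetric Leray–Hopf solution from rest that the crux asks for. -/
theorem stubComposition : StubComposition := by
  intro hA hB hC f hf
  obtain ⟨E, ν₁, hE, hν₁, hceil⟩ := hB f hf
  refine ⟨E, ν₁, hE, hν₁, fun ν hν hνlt => ?_⟩
  -- the resolution threshold of the Galerkin ceiling at this viscosity
  obtain ⟨N₀, hN₀⟩ := hceil ν hν hνlt
  -- a `K`-symmetric exact-force Hopf–Galerkin scheme from rest
  obtain ⟨N, U, hS, hsym⟩ := hA f hf ν hν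
  -- its tail beyond the threshold: orders `N n → ∞`
  obtain ⟨n₀, hn₀⟩ := Filter.tendsto_atTop_atTop.1 hS.tendsto_order N₀
  have hφ : StrictMono (fun n : ℕ => n + n₀) := fun a b hab => Nat.add_lt_add_right hab n₀
  have hS' : Literature.Analysis.FluidPDE.IsHopfGalerkinScheme ν (fun _ => f) 0 (fun n => N (n + n₀))
      (fun _ _ => f) (fun n => U (n + n₀)) :=
    hS.comp_strictMono hφ
  have hsym' : ∀ (n : ℕ) (t : ℝ), 0 ≤ t → ∀ (i j : Fin 3) (x : UnitAddTorus (Fin 3)),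
      (fun n => U (n + n₀)) n t (Function.update x i (-x i)) j =
        if j = i then -((fun n => U (n + n₀)) n t x j) else (fun n => U (n + n₀)) n t x j :=
    fun n t ht i j x => hsym (n + n₀) t ht i j x
  -- the ceiling along the tail (every order there is `≥ N₀`)
  have hbd' : ∀ (n : ℕ) (t : ℝ), 0 ≤ t → ∫ x, ‖(fun n => U (n + n₀)) n t x‖ ^ 2 ≤ E :=
    fun n t ht => hN₀ (fun n => N (n + n₀)) (fun n => U (n + n₀)) hS' hsym' n (hn₀ (n + n₀) (Nat.le_add_left n₀ n)) t ht
  -- the bounded symmetric tail has a bounded symmetric Leray–Hopf limit from rest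
  exact hC f hf ν E hν (fun n => N (n + n₀)) (fun n => U (n + n₀)) hS' hsym' hbd'

/-- **The registered skeleton theorem** (concludes the crux BY NAME, no hypotheses; `sorry` enters only through the
declared stubs): `MirrorBoundedFromRestTG` from `stub_mirrorSchemeFromRest` (LANDED), the ceiling B′ obtained from
`stub_galerkinTransientFromRest` (LANDED) + `stub_galerkinLateCeilingTrajFromRest` (open, trajectory form) by
`lateCeiling_of_traj` and `galerkinCeiling_of_transient_of_late` (reshaped
2026-08-17; formerly the single stub `stub_galerkinCeilingFromRest`),
`stub_limitInheritsMirrorBound` via `stubComposition`. -/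
theorem MirrorBoundedFromRestTG_of :
    Summit.AnomalousDissipation.AnomalousDissipation.Theses.PumpedMirror.MirrorBoundedFromRestTG :=
  stubComposition stub_mirrorSchemeFromRest
    (galerkinCeiling_of_transient_of_late stub_galerkinTransientFromRest
      (lateCeiling_of_traj stub_galerkinLateCeilingTrajFromRest))
    stub_limitInheritsMirrorBound

end Summit.AnomalousDissipation.AnomalousDissipation.Cruxes.MirrorBoundedFromRestTG.Birth
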